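import Summits.FinalStateConjecture.FinalStateConjecture.Theorems.EIHFluxBalanceInertialRecessionLorentz
import Literature.Geometry.Lorentzian.KerrWaveDecay

/-!
# Crux `AdiabaticMultiKerrILED` (line `Sketch`) — lab-frame zone geometry for the far-field transport

Helper file for the crux `stmt-FinalStateConjecture-14310`
(`Summit.FinalStateConjecture.FinalStateConjecture.Theses.ClusterCompleteness.AdiabaticMultiKerrILED`),
far-field stub `stub_farTransport`. For a hole in inertial motion with 4-velocity `u = Λ e₀`
(`0 < u⁰`, `‖u⃗‖ ≤ u⁰/10`), lab centre `c(t) = p + t v`, `v = u⃗/u⁰`, rest-frame coordinates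
`q = poincareInv Λ (0, p)`, spin `|a| ≤ M/10`, and the lab displacement `d = y − p − t v` of a lab
point `(t, y)`, the zone-kinematics sandwich `‖d‖² ≤ |z⃗|² ≤ (u⁰)² ‖d‖²` (`stub_zoneKinematics`, taken
here as a hypothesis) converts lab distances into rest-frame Kerr–Schild radii:

* `u_zero_sq_le` — `(u⁰)² ≤ 100/99`;
* `radius_gt_sixteen_of_norm_d_ge` — `‖d‖ ≥ 17M ⇒ 16M < r(q x)` (the far current lives in the flat region);
* `radius_lt_sixtyfour_of_norm_d_le` — `‖d‖ ≤ 35M ⇒ r(q x) < 64M` (the cut-off shells lie in the zones);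
* `rPlus_lt_radius_of_norm_d_gt` — `‖d‖ > 3M ⇒ r₊ < r(q x)` (exterior);
* `norm_d_gt_of_norm_gt` — `‖y‖ > ‖p‖ + t + 3M`, `0 ≤ s ≤ t` ⇒ `‖y − p − s v‖ > 3M` (far out there are no
  holes at any earlier lab time). [folklore]
-/

noncomputable section

-- the doubled `FinalStateConjecture.FinalStateConjecture` path component trips dupNamespace
set_option linter.dupNamespace false

open scoped ContDiff Topology
open Filter Set Literature.Geometry.Lorentzian Summit.FinalStateConjecture.FinalStateConjecture.Theorems

namespace Summit.FinalStateConjecture.FinalStateConjecture.Cruxes.AdiabaticMultiKerrILED.Sketch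

/-- **Lorentz factor of a slow hole**: `u = Λ e₀` with `‖u⃗‖ ≤ u⁰/10` has `(u⁰)² ≤ 100/99`. [folklore] -/
theorem u_zero_sq_le (Λ : lorentzGroup) {u : E4} (hu : u = (Λ : E4 ≃L[ℝ] E4) (E4.basisVector 0))
    (hv : 0 < u 0 ∧ ‖E4.spatial u‖ ≤ 1 / 10 * u 0) : (u 0) ^ 2 ≤ 100 / 99 := by
  have h := lorentz_apply_zero_sq Λ
  rw [← hu] at h
  have hs : E4.spatialNorm u ≤ 1 / 10 * u 0 := hv.2
  have hs0 : 0 ≤ E4.spatialNorm u := E4.spatialNorm_nonneg u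
  have hsq : E4.spatialNorm u ^ 2 ≤ (1 / 10 * u 0) ^ 2 := pow_le_pow_left₀ hs0 hs 2
  nlinarith

/-- `r² ≥ |z⃗|² − a²` for the Kerr–Schild radius. [folklore] -/
theorem spatialNorm_sq_sub_sq_le_radius_sq' (a : ℝ) (z : E4) :
    E4.spatialNorm z ^ 2 - a ^ 2 ≤ Kerr.radius a z ^ 2 := by
  rw [Kerr.radius_sq]
  have h := Kerr.abs_le_sqrt_radius_discr a z
  have h' := le_abs_self (E4.spatialNorm z ^ 2 - a ^ 2)
  linarith

section OneHole

variable {Λ : lorentzGroup} {p : E3} {u : E4} {q : E4 → E4} {M a : ℝ}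

/-- **Far from the moving centre the rest-frame radius is large**: `‖d‖ ≥ 17M ⇒ 16M < r(q x)`
(`|z⃗|² ≥ ‖d‖²`, `r² ≥ |z⃗|² − a²`, `|a| ≤ M/10`). [folklore] -/
theorem radius_gt_sixteen_of_norm_d_ge
    (hZG : ∀ (Λ : lorentzGroup) (p : E3) (u : E4) (q : E4 → E4),
      u = (Λ : E4 ≃L[ℝ] E4) (E4.basisVector 0) →
      (∀ x, q x = poincareInv Λ (E4.ofTimeSpace 0 p) x) → 0 < u 0 →
      ∀ (t : ℝ) (y : E3),
        ‖y - p - (t * (u 0)⁻¹) • E4.spatial u‖ ^ 2 ≤ E4.spatialNorm (q (E4.ofTimeSpace t y)) ^ 2 ∧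
        E4.spatialNorm (q (E4.ofTimeSpace t y)) ^ 2 ≤
          (u 0) ^ 2 * ‖y - p - (t * (u 0)⁻¹) • E4.spatial u‖ ^ 2)
    (hu : u = (Λ : E4 ≃L[ℝ] E4) (E4.basisVector 0))
    (hq : ∀ x, q x = poincareInv Λ (E4.ofTimeSpace 0 p) x) (hu0 : 0 < u 0) (hM : 0 < M)
    (ha : |a| ≤ 1 / 10 * M) {t : ℝ} {y : E3}
    (hd : 17 * M ≤ ‖y - p - (t * (u 0)⁻¹) • E4.spatial u‖) :
    16 * M < Kerr.radius a (q (E4.ofTimeSpace t y)) := by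
  have hkin := (hZG Λ p u q hu hq hu0 t y).1
  have hr := spatialNorm_sq_sub_sq_le_radius_sq' a (q (E4.ofTimeSpace t y))
  have ha2 : a ^ 2 ≤ (1 / 10 * M) ^ 2 := by
    have : |a| ≤ |1 / 10 * M| := ha.trans (le_abs_self _)
    exact sq_le_sq.mpr this
  have hd2 : (17 * M) ^ 2 ≤ ‖y - p - (t * (u 0)⁻¹) • E4.spatial u‖ ^ 2 :=
    pow_le_pow_left₀ (by positivity) hd 2
  have hsq : (16 * M) ^ 2 < Kerr.radius a (q (E4.ofTimeSpace t y)) ^ 2 := by nlinarith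
  exact lt_of_pow_lt_pow_left₀ 2 (Kerr.radius_nonneg _ _) hsq

/-- **Near the moving centre the rest-frame radius is small**: `‖d‖ ≤ 35M ⇒ r(q x) < 64M`
(`r ≤ |z⃗| ≤ u⁰ ‖d‖`, `(u⁰)² ≤ 100/99`). [folklore] -/
theorem radius_lt_sixtyfour_of_norm_d_le
    (hZG : ∀ (Λ : lorentzGroup) (p : E3) (u : E4) (q : E4 → E4),
      u = (Λ : E4 ≃L[ℝ] E4) (E4.basisVector 0) →
      (∀ x, q x = poincareInv Λ (E4.ofTimeSpace 0 p) x) → 0 < u 0 →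
      ∀ (t : ℝ) (y : E3),
        ‖y - p - (t * (u 0)⁻¹) • E4.spatial u‖ ^ 2 ≤ E4.spatialNorm (q (E4.ofTimeSpace t y)) ^ 2 ∧
        E4.spatialNorm (q (E4.ofTimeSpace t y)) ^ 2 ≤
          (u 0) ^ 2 * ‖y - p - (t * (u 0)⁻¹) • E4.spatial u‖ ^ 2)
    (hu : u = (Λ : E4 ≃L[ℝ] E4) (E4.basisVector 0))
    (hq : ∀ x, q x = poincareInv Λ (E4.ofTimeSpace 0 p) x)
    (hv : 0 < u 0 ∧ ‖E4.spatial u‖ ≤ 1 / 10 * u 0) (hM : 0 < M) {t : ℝ} {y : E3}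
    (hd : ‖y - p - (t * (u 0)⁻¹) • E4.spatial u‖ ≤ 35 * M) :
    Kerr.radius a (q (E4.ofTimeSpace t y)) < 64 * M := by
  have hkin := (hZG Λ p u q hu hq hv.1 t y).2
  have hu2 := u_zero_sq_le Λ hu hv
  have hrs := Kerr.radius_le_spatialNorm a (q (E4.ofTimeSpace t y))
  have hr0 := Kerr.radius_nonneg a (q (E4.ofTimeSpace t y))
  have hd0 : 0 ≤ ‖y - p - (t * (u 0)⁻¹) • E4.spatial u‖ := norm_nonneg _
  have hd2 : ‖y - p - (t * (u 0)⁻¹) • E4.spatial u‖ ^ 2 ≤ (35 * M) ^ 2 := pow_le_pow_left₀ hd0 hd 2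
  have hsn : E4.spatialNorm (q (E4.ofTimeSpace t y)) ^ 2 ≤ 100 / 99 * (35 * M) ^ 2 := by
    calc E4.spatialNorm (q (E4.ofTimeSpace t y)) ^ 2
        ≤ (u 0) ^ 2 * ‖y - p - (t * (u 0)⁻¹) • E4.spatial u‖ ^ 2 := hkin
      _ ≤ 100 / 99 * (35 * M) ^ 2 := mul_le_mul hu2 hd2 (sq_nonneg _) (by norm_num)
  have hlt : Kerr.radius a (q (E4.ofTimeSpace t y)) ^ 2 < (64 * M) ^ 2 := by
    have := pow_le_pow_left₀ hr0 hrs 2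
    nlinarith
  exact lt_of_pow_lt_pow_left₀ 2 (by positivity) hlt

/-- **Outside thrice the mass radius the point is exterior**: `‖d‖ > 3M ⇒ r₊ < r(q x)`
(`r² ≥ ‖d‖² − a² > 9M² − M²/100 > 4M² ≥ r₊²`). [folklore] -/
theorem rPlus_lt_radius_of_norm_d_gt
    (hZG : ∀ (Λ : lorentzGroup) (p : E3) (u : E4) (q : E4 → E4),
      u = (Λ : E4 ≃L[ℝ] E4) (E4.basisVector 0) →
      (∀ x, q x = poincareInv Λ (E4.ofTimeSpace 0 p) x) → 0 < u 0 →
      ∀ (t : ℝ) (y : E3),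
        ‖y - p - (t * (u 0)⁻¹) • E4.spatial u‖ ^ 2 ≤ E4.spatialNorm (q (E4.ofTimeSpace t y)) ^ 2 ∧
        E4.spatialNorm (q (E4.ofTimeSpace t y)) ^ 2 ≤
          (u 0) ^ 2 * ‖y - p - (t * (u 0)⁻¹) • E4.spatial u‖ ^ 2)
    (hu : u = (Λ : E4 ≃L[ℝ] E4) (E4.basisVector 0))
    (hq : ∀ x, q x = poincareInv Λ (E4.ofTimeSpace 0 p) x) (hu0 : 0 < u 0) (hM : 0 < M)
    (ha : |a| ≤ 1 / 10 * M) {t : ℝ} {y : E3}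
    (hd : 3 * M < ‖y - p - (t * (u 0)⁻¹) • E4.spatial u‖) :
    Kerr.rPlus M a < Kerr.radius a (q (E4.ofTimeSpace t y)) := by
  have hkin := (hZG Λ p u q hu hq hu0 t y).1
  have hr := spatialNorm_sq_sub_sq_le_radius_sq' a (q (E4.ofTimeSpace t y))
  have ha2 : a ^ 2 ≤ (1 / 10 * M) ^ 2 := by
    have : |a| ≤ |1 / 10 * M| := ha.trans (le_abs_self _)
    exact sq_le_sq.mpr this
  have hd2 : (3 * M) ^ 2 < ‖y - p - (t * (u 0)⁻¹) • E4.spatial u‖ ^ 2 :=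
    pow_lt_pow_left₀ hd (by positivity) two_ne_zero
  have hrp : Kerr.rPlus M a ≤ 2 * M := by
    unfold Kerr.rPlus
    have : Real.sqrt (M ^ 2 - a ^ 2) ≤ M := by
      calc Real.sqrt (M ^ 2 - a ^ 2) ≤ Real.sqrt (M ^ 2) :=
            Real.sqrt_le_sqrt (sub_le_self _ (sq_nonneg a))
        _ = M := Real.sqrt_sq hM.le
    linarith
  have hrp0 : 0 ≤ Kerr.rPlus M a := by unfold Kerr.rPlus; positivity
  have hsq : Kerr.rPlus M a ^ 2 < Kerr.radius a (q (E4.ofTimeSpace t y)) ^ 2 := by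
    have h4 : Kerr.rPlus M a ^ 2 ≤ (2 * M) ^ 2 := pow_le_pow_left₀ hrp0 hrp 2
    nlinarith
  exact lt_of_pow_lt_pow_left₀ 2 (Kerr.radius_nonneg _ _) hsq

end OneHole

/-- **Far out there are no holes at any earlier lab time**: if `‖y‖ > ‖p‖ + t + 3M` and `0 ≤ s ≤ t`,
and the lab speed is `≤ 1`, then `‖y − p − s v‖ > 3M`. [folklore] -/
theorem norm_d_gt_of_norm_gt {p v y : E3} {M t s : ℝ} (hv : ‖v‖ ≤ 1) (hs0 : 0 ≤ s) (hst : s ≤ t)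
    (hy : ‖p‖ + t + 3 * M < ‖y‖) : 3 * M < ‖y - p - s • v‖ := by
  have h1 : ‖y‖ - ‖p‖ - ‖s • v‖ ≤ ‖y - p - s • v‖ := by
    have := norm_sub_norm_le y (p + s • v)
    have h' : ‖p + s • v‖ ≤ ‖p‖ + ‖s • v‖ := norm_add_le _ _
    rw [show y - p - s • v = y - (p + s • v) by abel]
    linarith
  have h2 : ‖s • v‖ ≤ t := by
    rw [norm_smul, Real.norm_eq_abs, abs_of_nonneg hs0]
    calc s * ‖v‖ ≤ s * 1 := mul_le_mul_of_nonneg_left hv hs0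
      _ = s := mul_one s
      _ ≤ t := hst
  linarith

/-- The lab velocity `v = u⃗/u⁰` of a slow hole has `‖v‖ ≤ 1/10 ≤ 1`. [folklore] -/
theorem norm_velocity_le {u : E4} (hv : 0 < u 0 ∧ ‖E4.spatial u‖ ≤ 1 / 10 * u 0) :
    ‖(u 0)⁻¹ • E4.spatial u‖ ≤ 1 / 10 := by
  rw [norm_smul, Real.norm_eq_abs, abs_of_pos (inv_pos.mpr hv.1)]
  rw [inv_mul_le_iff₀ hv.1]
  linarith [hv.2]

end Summit.FinalStateConjecture.FinalStateConjecture.Cruxes.AdiabaticMultiKerrILED.Sketch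

end
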